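import Summits.QuantumFields.QCD.Theses.PauliWegnerSea
import Summits.QuantumFields.QCD.Theses.WilsonMobilityGap
import Literature.MathematicalPhysics.QuantumFieldTheory.QCDPhaseQuenchedReweighting
import Summits.QuantumFields.QCD.Theorems.GluonicCompletion.Negative.Threshold
import Summits.QuantumFields.QCD.Theorems.GluonicCompletion.Negative.Reweighting
import Summits.QuantumFields.QCD.Theorems.GluonicCompletion.Negative.Flanks
import Summits.QuantumFields.QCD.Theorems.GluonicCompletion.Negative.SignRatio
import HarnessLib.Audit

/-!
# Line `fibre-flatness-conditional-package` — skeleton for crux `PauliWegnerSea.GluonicCompletion`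
(item stmt-QuantumFields-9152; routes route-QuantumFields-PauliWegnerSea rank 7 [primary],
route-QuantumFields-WilsonMobilityGap rank 4 — the two route copies are `rfl`-equal, Disproof `eq_wilsonMobilityGap`)

Crux `G`: `∀ N_f ∈ {2,3}, H N_f → QCDOf N_f`, with `H N_f = ∃ reg, HasMassScaling ∧ HasAsymptoticScaling ∧
∀ m > 0, ((i) ∧ (ii) ∧ (iii) ∧ (iv)) ∧ PQFD`.

**Idea** (card `Cruxes/GluonicCompletion/Ideas/fibre-flatness-conditional-package.md`, triage r1-1/2/3: pass).
Every engine that manufactures the all-volume clause `HasLatticeMassGap` of `QCDOf` for a non-product measure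
(Kotecký–Preiss block expansion relative to a mixing reference, finite-size criteria, the sign-defect gas)
consumes CONDITIONAL inputs — block activities bounded uniformly in the (typical) environment, at a complex twist
`|η| ≤ η₀` (the sign kernel is an `η`-integral of twisted propagators), locally uniformly in the renormalised
masses `m ∈ K` (the `∀ m` hole: `QCDOf` binds ONE `reg'` before `∀ m`). Clause (ii) of `H` is global,
`η = 0`, `m`-pointwise. The FIBRE lemmas of route PauliWegnerSea are environment-, twist- and mass-uniform BY
STATEMENT (degree-only constants: the Wilson sea is band-limited of bidegree `≤ (6,6)` per link per flavour,
and the twist `−iηΓ₅` is link-independent — `TwistedPauliBandLimit`, true by the rank count of `PauliBandLimit`,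
triage ×3). So the fermionic input of the completion is re-minted from the fibre lemmas seeded by (ii)
(stubs 1–3), and the Yang–Mills-hard remainder is stated ONCE in the currency the engine converts (stubs 4–6).
Following the panel's merge note (r1-3: "fibre-flatness ≈ finite-sign-budget, one architecture"), the skeleton
realises the architecture of FINDINGS-ideator1: conditional quark decay · glue core · defect gas ⇒ signed
all-volume lattice gap · T-side at the scheme volume with one subsequence for all masses.

**Currencies** (INLINED below, verbatim the importable sibling module `Lines/FibreFlatnessPackage.lean` — module
`Summits.QuantumFields.QCD.Cruxes.GluonicCompletion.Lines.FibreFlatnessPackage`, same namespace, which provers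
closing a stub should import to state it by the same names once the hub has built it — otherwise paste the same
text; this hyphenated skeleton is not itself a module.
Transparent abbreviations over tree vocabulary only; `ClauseI…IV` are the four per-mass clauses of `H` VERBATIM,
so the composition destructures `H` into them definitionally):
* `LocalFibreDomination` (K1_loc) — two-star fibre cofactor domination for the DIRICHLET-cut, `η`-twisted
  Wilson–Dirac operator on a box `Λ_r` of the torus, constant `C₀ (1+r)^{p₀}` (local count ≤ dimension) in
  place of K1's GLOBAL in-window count `1 + n_w(U)` (triage r1-2 sharpen A), constants uniform in
  `m₀ ∈ [−2,2]`, `|η| ≤ 1`.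
* `BandLimitedFlatness` (K3_gen) — `TiltedFlatness` (11511) restated for EVERY function of the type the line
  meets: products over `n ≤ N` flavours of `|det|` of Dirichlet-cut, twisted Wilson–Dirac operators (any box,
  any masses in `[−2,2]`, any twists `|η_f| ≤ 1`), under the star-conditional Wilson law — the `η`-twisted weight
  is NOT an instance of 11511 (triage r1-1 (b), r1-3), so the general band-limited form is the stub.
* `CondDecay N_f reg` — conditional (given the links outside a box), twisted, `m`-locally-uniform fractional-moment
  decay of the Dirichlet-cut quark propagator deep inside the box, for all environments outside a rare measurable
  set `Bad` (`⟨1_Bad⟩₊ ≤ C a_k^q`, every `q`): the "ConditionalFMDecay" currency triage r1-1 (a) / r1-3 asked for.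
* `GlueCore N_f reg` — strong mixing at a physical rate of the phase-quenched conditional law of a box (inner
  observables vs. the environment outside, prefactor in PHYSICAL units), for all environments outside a rare `Bad`,
  `m`-locally uniform; stated for the COUPLED system (gauge weight × `∏_f |det D_f|` of the FULL torus operator —
  the non-local weight is kept, triage r1-2 sharpen B). Rare-environment form because total-variation closeness
  uniformly over ALL lattice-rough environments fails already for a free field near its continuum limit.
* `LatticeGapUniform N_f reg` — the `HasLatticeMassGap` inequality for ALL gauge-invariant local lattice QCD
  observables on ALL tori `S ≥ L_k`, SIGNED functional, constants locally uniform in `m`.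

**Stubs** (6) and where `H` enters (triage r1-1 (c), r1-3: "say which clauses the line consumes"):
1. `stub_localFibreDomination : LocalFibreDomination` — deterministic linear algebra (K1 mechanism:
   `γ₅`-hermiticity, two-star Schur complement), size L.
2. `stub_bandLimitedFlatness : BandLimitedFlatness` — harmonic analysis on `SU(3)^16` (Nikolskii/Remez/
   Carbery–Wright for bidegree-`≤ (6n,6n)` matrix coefficients under a log-concave-cored tilt), size M–L.
3. `stub_conditionalFMDecay` — K1_loc → K3_gen → [(i), (ii) of `H`] → `CondDecay`: the ASFH finite-volume
   bootstrap run INSIDE boxes, a-priori bound and decoupling supplied FIBREWISE (environment-uniform by statement,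
   no independence), smallness SEED at one log-scale from (ii) transported to all but rare environments by Markov's
   inequality (the `Bad` sets; union bounds paid from the `a_k^q` room); the `m`-local uniformity is MANUFACTURED
   here (F3: `H` is `m`-pointwise). Size L (≥ FMClosureUnquenched 11512). USES (i), (ii). No gluonic input.
4. `stub_glueCore` — [HasMassScaling, HasAsymptoticScaling, (i), (ii)] → K1_loc → K3_gen → `CondDecay` →
   `GlueCore`: asymptotically free trajectory + screened quarks ⇒ gluonic strong mixing at a physical scale for
   typical environments. Open-problem size (the Yang–Mills mass gap in finite-size form). USES scaling, (i), (ii).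
5. `stub_defectGasLatticeGap` — [(iv)] → K1_loc → K3_gen → `GlueCore` → `CondDecay` → `LatticeGapUniform`:
   DefectLocality (the sign `∏_f sgn det D_f` through the `η`-integral of twisted propagators is a product of
   quasi-local factors off rare sets), DefectRarity ((iv) at the diverging physical volume `(a_k(2L_k+1))⁴`
   forces the defect density per physical volume to `0`), Kotecký–Preiss expansion of the defect- and
   bad-block-decorated measure relative to the `GlueCore` reference; fermionic observables through Jacobi-WHOLE
   complementary minors (one minor per flavour, F4 of `one-minor-per-flavour`; the band limit covers minors).
   Open-problem size (the crux's own why-might-fail lives here). USES (iv).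
6. `stub_continuumPackage` — [scaling, (i), (iii), (iv)] → `GlueCore` → `CondDecay` → `LatticeGapUniform` →
   `∃ φ StrictMono, ∀ m > 0, ∃ z shift T, IsQCDAlong ((reg∘φ).scheme m z shift) T ∧ non-trivial ∧ non-Gaussian
   ∧ non-decoupled ∧ ∃ Δ > 0, T.HasMassGap Δ`: the T-side at the scheme volume `S = L_k` (F1: every OS clause of
   `QCDOf` lives there, where (iv) makes honest = phase-quenched up to a factor 2 for norm-INSIDE quantities —
   `Negative.detRatio_le_two_mul_absMoment`), ONE subsequence for all masses by Arzelà–Ascoli in `m` from the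
   `m`-locally-uniform clustering, (iii) ⇒ `IsNontrivial (pseudoRe f g)`, (i) ⇒ the physical-branch clause of
   `IsQCDAlong`. Open-problem size (UV: continuum limit with E0–E4, non-Gaussian glue). USES scaling, (i), (iii), (iv).
`PQFD` (the last clause of `H`, norm OUTSIDE the gauge integral) is deliberately NOT consumed: by
`Negative.reweighting_not_bookkeeping` it bounds nothing signed; stub 5 re-derives flavour-charged decay in the
norm-inside form from `CondDecay` (cf. `Negative.chargedConnectedCorr_decay_at_own_side`).

**Composition** `GluonicCompletion_of` (sorry-free): destructure `H`; stubs 3 → 4 → 5 → 6; `reg' := subseq reg φ`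
(`HasMassScaling` passes to subsequences); for each `m > 0` take `Δ := min Δ_T Δ_K` with `K = [min m, max m]`
(`exists_massWindow`), `T.HasMassGap` and the lattice inequality being antitone in `Δ` (`hasMassGap_anti`,
`latticeBound_anti`), and read `LatticeGapUniform` along `φ` (`StrictMono.tendsto_atTop`). It concludes
`Summit.QuantumFields.QCD.Theses.PauliWegnerSea.GluonicCompletion` BY NAME (and, by `rfl`-transport, the sibling copy
`WilsonMobilityGap.GluonicCompletion`: `GluonicCompletion_of_wilsonMobilityGap`).

**Disproof used** (cdisprove g2 rev 3, evidence notes on stmt-9152; the file body is not mounted in this seat,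
its LANDED extracts are imported above and the skeleton is checked against them):
* no `_false_without_<H>` theorem exists short of `¬QCD` (`Negative.withoutPerMass_iff_QCD`): the line is free
  to drop `PQFD`; it USES (i) [stubs 3,4,6], (ii) [3,4], (iii) [6], (iv) [5,6], both scaling clauses [4,6];
* §7 `Negative.reweighting_not_bookkeeping` / `detRatio_le_two_mul_absMoment`: no stub feeds a norm-outside
  phase-quenched bound through the factor-2 reweighting; stub 6's T-side budget is norm-inside;
* `Negative.signRatio_le_one` / `not_eventually_le_signRatio_of_one_lt`: no stub asks sign coherence with a
  constant `> 1` or on tori `S > L_k` (`example` below); all-volume sign control is stub 5's OUTPUT, never an input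
  (`chargedLatticeGap_of_allVolume_signCoherence` isolates exactly what `H` does not give; `blocks_half_le_pow_all_iff`);
* `Negative.qcdLatticeConnectedCorr_eq_zero_of_signedZ_eq_zero` (junk where `Z_signed = 0`): stub 6 does NOT
  infer the continuum gap from the lattice inequality at `S > L_k` (which may be junk or hide behind vanishing
  normalisations); it produces its own `Δ_T` at the scheme volume and the composition takes `min`;
* `Negative.qcdOf_iff_threshold` / `scheme_mcrit_shift` and the offset-interleaving flank (triage r1-1 S3,
  `UVStabilityNonUniqueness`): every stub conclusion is bounds-type (closed under interleaving) or carries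
  `∃ φ StrictMono` — no full-sequence convergence along `reg` itself is claimed.
No stub is an instance refuted by a landed Negative lemma; negatives index (9494, 9599, 9603, 9665) untouched.
-/

noncomputable section

open MeasureTheory Filter
open Literature.MathematicalPhysics.QuantumFieldTheory Literature.MathematicalPhysics.QuantumLattice
  Literature.Probability.LatticeModels
open scoped BigOperators Classical

namespace Summit.QuantumFields.QCD.Cruxes.GluonicCompletion.FibreFlatnessConditionalPackage

variable {Nf : ℕ}

/-! ## Currencies (verbatim `Lines/FibreFlatnessPackage.lean`) -/
/-- Clause (i) of the per-mass package of `H` for `(reg, m)` — verbatim: bare masses on the physical branch. -/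
def ClauseI (reg : QCDRegularisation Nf) (m : Fin Nf → ℝ) : Prop :=
  ∀ f : Fin Nf, ∀ᶠ k in atTop, -1 < reg.mcrit k + reg.a k * m f / reg.Zm k

/-- Clause (ii) of `H` for `(reg, m)` — verbatim: phase-quenched fractional-moment decay of the quark propagator,
global (full torus), untwisted, with `m`-pointwise constants. Consumed by stubs 3 and 4 only as a SEED. -/
def ClauseII (reg : QCDRegularisation Nf) (m : Fin Nf → ℝ) : Prop :=
  ∃ s δ C : ℝ, 0 < s ∧ s < 1 ∧ 0 < δ ∧ ∀ᶠ k in atTop, ∀ S : ℕ, reg.L k ≤ S → ∀ (f : Fin Nf) (v : Literature.Probability.LatticeModels.Site 4), v ∈ box 4 S → (∫ U : GaugeConfig 4 (2 * S + 1) (Matrix.specialUnitaryGroup (Fin 3) ℂ), ‖(diracMatrix U fun fl => reg.mcrit k + reg.a k * m fl / reg.Zm k).det‖ * (∑ a : Fin 3, ∑ i : Fin 4, ∑ b : Fin 3, ∑ j : Fin 4, ‖(diracMatrix U fun fl => reg.mcrit k + reg.a k * m fl / reg.Zm k)⁻¹ (quarkEquiv (f, (Torus.proj (2 * S + 1) 0,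 a, i))) (quarkEquiv (f, (Torus.proj (2 * S + 1) (v), b, j)))‖) ^ s ∂(wilsonMeasure (fundamentalRep (Fin 3)) (reg.β k))) / (∫ U : GaugeConfig 4 (2 * S + 1) (Matrix.specialUnitaryGroup (Fin 3) ℂ), ‖(diracMatrix U fun fl => reg.mcrit k + reg.a k * m fl / reg.Zm k).det‖ ∂(wilsonMeasure (fundamentalRep (Fin 3)) (reg.β k))) ≤ C * Real.exp (-(δ * (reg.a k * ‖v‖)))

/-- Clause (iii) of `H` for `(reg, m)` — verbatim: quarks are not lattice-heavy (lower bound). Consumed by stub 6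
(non-decoupling of the flavour-changing pseudoscalars). -/
def ClauseIII (reg : QCDRegularisation Nf) (m : Fin Nf → ℝ) : Prop :=
  ∃ s c₀ C₁ p : ℝ, 0 < s ∧ s < 1 ∧ 0 < c₀ ∧ ∀ᶠ k in atTop, ∀ S : ℕ, reg.L k ≤ S → ∀ (f : Fin Nf) (n : ℕ), n ≤ S → c₀ * Real.exp (-(C₁ * (reg.a k * n) + p * Real.log (n + 1))) ≤ (∫ U : GaugeConfig 4 (2 * S + 1) (Matrix.specialUnitaryGroup (Fin 3) ℂ), ‖(diracMatrix U fun fl => reg.mcrit k + reg.a k * m fl / reg.Zm k).det‖ * (∑ a : Fin 3, ∑ i : Fin 4, ∑ b : Fin 3, ∑ j : Fin 4, ‖(diracMatrix U fun fl => reg.mcrit k + reg.a k * m fl / reg.Zm k)⁻¹ (quarkEquiv (f, (Torus.proj (2 * S + 1) 0, a, i))) (quarkEquiv (f, (Torus.proj (2 * S + 1) (Pi.single 0 (n : ℤ)), b, j)))‖) ^ s ∂(wilsonMeasure (fundamentalRep (Fin 3)) (reg.β k))) / (∫ U : GaugeConfig 4 (2 * S + 1) (Matrix.specialUnitaryGroup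 (Fin 3) ℂ), ‖(diracMatrix U fun fl => reg.mcrit k + reg.a k * m fl / reg.Zm k).det‖ ∂(wilsonMeasure (fundamentalRep (Fin 3)) (reg.β k)))

/-- Clause (iv) of `H` for `(reg, m)` — verbatim: sign coherence `≥ ½` at the scheme's OWN side `2L_k+1` only.
Consumed by stub 5 (defect rarity by extensivity) and stub 6 (factor-2 budget at the scheme volume). -/
def ClauseIV (reg : QCDRegularisation Nf) (m : Fin Nf → ℝ) : Prop :=
  ∀ᶠ k in atTop, (1 / 2 : ℝ) ≤ ‖∫ U : GaugeConfig 4 (2 * reg.L k + 1) (Matrix.specialUnitaryGroup (Fin 3) ℂ), (diracMatrix U fun fl => reg.mcrit k + reg.a k * m fl / reg.Zm k).det ∂(wilsonMeasure (fundamentalRep (Fin 3)) (reg.β k))‖ / (∫ U : GaugeConfig 4 (2 * reg.L k + 1) (Matrix.specialUnitaryGroup (Fin 3) ℂ), ‖(diracMatrix U fun fl => reg.mcrit k + reg.a k * m fl / reg.Zm k).det‖ ∂(wilsonMeasure (fundamentalRep (Fin 3)) (reg.β k)))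

/-- **K1_loc — local two-star fibre cofactor domination** (the deterministic fibre lemma, Dirichlet-cut and
twisted). There are `C₀ > 0`, `p₀` such that for every bare mass `m₀ ∈ [−2,2]`, twist `|η| ≤ 1`, torus of side
`L ≥ 4`, box `Λ_r = proj(box 4 r)`, background `U` and sites `x ≠ y ∈ Λ_r`: with `refit W` = `U` with the links of
`star(x) ∪ star(y)` replaced by those of `W`, and `D(V)` = the Wilson–Dirac matrix of `V` at mass `m₀`, `r = 1`,
twisted by `−iη Γ₅`, CUT to `Λ_r` (entries with both sites in `Λ_r` kept, identity on the complement, no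
coupling across — so `det D = det D_Λ`, `adj D|_Λ = adj D_Λ`),
`∀ W ∃ W', Σ_{a,i,b,j} ‖adj D(refit W)_{(x,a,i),(y,b,j)}‖ ≤ C₀ (1+r)^{p₀} ‖det D(refit W')‖`.
For `2r+1 ≥ L` the cut is the full periodic operator and this is K1 (11510) with `1 + n_w ≤ 13 L⁴` absorbed in
`(1+r)^{p₀}`; for genuine boxes it is K1 for the Dirichlet operator, whose in-window count is at most its dimension.
Mechanism as K1 (`γ₅`-hermiticity: every pole of `adj/det` carries the same `H_W`-eigenvector at both ends; a
simple zero mode supported off `{x,y}` kills `adj_xy` too); at `η ≠ 0` it holds trivially with `C = 1/|η|`, the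
content is uniformity as `η → 0`. -/
def LocalFibreDomination : Prop :=
  ∃ (C₀ : ℝ) (p₀ : ℕ), 0 < C₀ ∧ ∀ (m₀ η : ℝ), -2 ≤ m₀ → m₀ ≤ 2 → |η| ≤ 1 →
    ∀ (L : ℕ) [NeZero L], 4 ≤ L → ∀ (r : ℕ) (U : GaugeConfig 4 L SU3) (x y : TorusSite 4 L), x ≠ y →
      (∃ u ∈ box 4 r, Torus.proj L u = x) → (∃ v ∈ box 4 r, Torus.proj L v = y) →
      let Λ : TorusSite 4 L → Prop := fun z => ∃ w ∈ box 4 r, Torus.proj L w = z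
      let star : Edge 4 L → Prop := fun e =>
        e.1 = x ∨ Site.shift e.1 e.2 = x ∨ e.1 = y ∨ Site.shift e.1 e.2 = y
      let refit : GaugeConfig 4 L SU3 → GaugeConfig 4 L SU3 := fun W e => if star e then W e else U e
      let D : GaugeConfig 4 L SU3 →
          Matrix (TorusSite 4 L × Fin 3 × Fin 4) (TorusSite 4 L × Fin 3 × Fin 4) ℂ := fun V =>
        let Dfull : Matrix (TorusSite 4 L × Fin 3 × Fin 4) (TorusSite 4 L × Fin 3 × Fin 4) ℂ :=
          wilsonDirac (fundamentalRep (Fin 3)) V m₀ 1 -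
            ((η : ℂ) * Complex.I) • spinorLift (L := L) (N := 3) gammaFive
        Matrix.of fun p q => if Λ p.1 ∧ Λ q.1 then Dfull p q else if p = q then 1 else 0
      ∀ W : GaugeConfig 4 L SU3, ∃ W' : GaugeConfig 4 L SU3,
        (∑ a : Fin 3, ∑ i : Fin 4, ∑ b : Fin 3, ∑ j : Fin 4, ‖(D (refit W)).adjugate (x, a, i) (y, b, j)‖) ≤
          C₀ * (1 + (r : ℝ)) ^ p₀ * ‖(D (refit W')).det‖

/-- **K3_gen — tilted flatness for every band-limited weight the line meets** (`TiltedFlatness` 11511 is the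
case: full torus, `η = 0`, `n = N_f`, via `det_diracMatrix`). For every `N` there are `C, p, c > 0` such that for
every `β ≥ 0`, `n ≤ N`, masses `mq ∈ [−2,2]^n`, twists `|η_f| ≤ 1`, torus `L ≥ 4`, box radius `r`, background `U`
and sites `x, y`: with `F(W) = ∏_{f<n} |det D_f(refit W)|` (`D_f` = Wilson–Dirac at `mq f`, twisted by
`−iη_f Γ₅`, cut to `Λ_r`; band-limited of bidegree `≤ (6n, 6n)` in each of the `≤ 16` star links — Pauli, and
`TwistedPauliBandLimit`: the twist is link-independent), `wt(W) = exp(−β S_W(refit W))`, `Z = ∫ wt dHaar`,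
`M = ∫ F wt dHaar / Z`: (a) `F(W₀) ≤ C (1+β)^p M` for all `W₀`; (b) if `M > 0`, `∫ 1{F ≤ εM} wt / Z ≤ C ε^c`.
Constants depend on the DEGREE (`N`) only — uniformly in `β`, masses, twists, the box, the volume and the OUTSIDE
configuration. Inherits 11511's recorded risk ((b) uniformly in `β`: two minimising branches of the tilted
action ⇒ an atom of `F/M` at `0`). -/
def BandLimitedFlatness : Prop :=
  ∀ N : ℕ, ∃ C p c : ℝ, 0 < C ∧ 0 < c ∧ ∀ β : ℝ, 0 ≤ β → ∀ n : ℕ, n ≤ N →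
    ∀ (mq η : Fin n → ℝ), (∀ f, -2 ≤ mq f ∧ mq f ≤ 2) → (∀ f, |η f| ≤ 1) →
    ∀ (L : ℕ) [NeZero L], 4 ≤ L → ∀ (r : ℕ) (U : GaugeConfig 4 L SU3) (x y : TorusSite 4 L),
      let Λ : TorusSite 4 L → Prop := fun z => ∃ w ∈ box 4 r, Torus.proj L w = z
      let star : Edge 4 L → Prop := fun e =>
        e.1 = x ∨ Site.shift e.1 e.2 = x ∨ e.1 = y ∨ Site.shift e.1 e.2 = y
      let refit : GaugeConfig 4 L SU3 → GaugeConfig 4 L SU3 := fun W e => if star e then W e else U e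
      let D : Fin n → GaugeConfig 4 L SU3 →
          Matrix (TorusSite 4 L × Fin 3 × Fin 4) (TorusSite 4 L × Fin 3 × Fin 4) ℂ := fun f V =>
        let Dfull : Matrix (TorusSite 4 L × Fin 3 × Fin 4) (TorusSite 4 L × Fin 3 × Fin 4) ℂ :=
          wilsonDirac (fundamentalRep (Fin 3)) V (mq f) 1 -
            ((η f : ℂ) * Complex.I) • spinorLift (L := L) (N := 3) gammaFive
        Matrix.of fun p q => if Λ p.1 ∧ Λ q.1 then Dfull p q else if p = q then 1 else 0
      let F : GaugeConfig 4 L SU3 → ℝ := fun W => ∏ f : Fin n, ‖(D f (refit W)).det‖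
      let wt : GaugeConfig 4 L SU3 → ℝ := fun W =>
        Real.exp (-(β * wilsonAction (fundamentalRep (Fin 3)) (refit W)))
      let haar : Measure (GaugeConfig 4 L SU3) := Measure.pi fun _ => haarProbability SU3
      let Z : ℝ := ∫ W, wt W ∂haar
      let M : ℝ := (∫ W, F W * wt W ∂haar) / Z
      (∀ W₀ : GaugeConfig 4 L SU3, F W₀ ≤ C * (1 + β) ^ p * M) ∧
        (0 < M → ∀ ε : ℝ, 0 < ε → (∫ W, (if F W ≤ ε * M then (1 : ℝ) else 0) * wt W ∂haar) / Z ≤ C * ε ^ c)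

/-- **CondDecay — conditional, twisted, mass-locally-uniform fractional-moment decay, for all but rare
environments** (the currency the completion engine consumes; the conclusion of stub 3). For every compact mass
window `[mlo, mhi]`, `0 < mlo`, and every power `q` there are `s ∈ (0,1)`, `δ, C, η₀ > 0` such that for all large
`k`, every torus `S ≥ L_k`, every mass tuple in the window, every twist `|η_f| ≤ η₀` and every GENUINE box
`Λ_r = proj(box 4 r)`, `r < S` (Dirichlet cut, no wrap-around), there is a measurable set `Bad` of configurations of
phase-quenched probability `⟨1_Bad⟩₊ ≤ C a_k^q` such that for every environment `U ∉ Bad`, every flavour `f` and all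
sites `u, v` of the INNER half-box `box 4 (r/2)`:
`E[ (Σ_{a,i,b,j} |(D_cut,η)⁻¹_{(f,u,a,i),(f,v,b,j)}|)^s | links outside Λ_r = U ] ≤ C exp(−δ a_k ‖u − v‖_∞)`,
the conditional law of the inside links (both endpoints in `Λ_r`) being the phase-quenched one: density
`∝ |det diracMatrix(refit W; m(k))| · exp(−β_k S_W(refit W))` w.r.t. product Haar (FULL-torus, UNtwisted determinant
weight; only the observable is cut and twisted). Rate `δ` physical; `C` uniform in `k`, `S`, the good environments,
the box and `m ∈ K`. Why "all but rare environments" and "inner half-box": a uniform bound over ALL environments up to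
the box boundary would have to survive environment-induced rough boundary layers (in-gap modes of `H_W` along `∂Λ_r`);
deep inside, reaching such a layer already costs the claimed rate, and atypical coherent environments are excised by
`Bad` (their rarity is what (ii) + the fibre lemmas give by Markov — stub 3). Junk-safe: a vanishing or non-integrable
fibre integral reads `0 ≤ …`. -/
def CondDecay (Nf : ℕ) (reg : QCDRegularisation Nf) : Prop :=
  ∀ mlo mhi : ℝ, 0 < mlo → mlo ≤ mhi → ∀ q : ℕ,
    ∃ s δ C η₀ : ℝ, 0 < s ∧ s < 1 ∧ 0 < δ ∧ 0 < η₀ ∧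
      ∀ᶠ k in atTop, ∀ S : ℕ, reg.L k ≤ S →
        ∀ m : Fin Nf → ℝ, (∀ f, mlo ≤ m f ∧ m f ≤ mhi) →
        ∀ η : Fin Nf → ℝ, (∀ f, |η f| ≤ η₀) →
        ∀ r : ℕ, r < S →
          let mb : Fin Nf → ℝ := fun fl => reg.mcrit k + reg.a k * m fl / reg.Zm k
          ∃ Bad : Set (GaugeConfig 4 (2 * S + 1) SU3), MeasurableSet Bad ∧
            qcdPhaseQuenchedExpect (reg.β k) (2 * S + 1) mb (Bad.indicator fun _ => (1 : ℝ)) ≤ C * reg.a k ^ q ∧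
            ∀ (U : GaugeConfig 4 (2 * S + 1) SU3), U ∉ Bad →
            ∀ (f : Fin Nf) (u v : Literature.Probability.LatticeModels.Site 4),
              u ∈ box 4 (r / 2) → v ∈ box 4 (r / 2) →
              let Λ : TorusSite 4 (2 * S + 1) → Prop := fun z => ∃ w ∈ box 4 r, Torus.proj (2 * S + 1) w = z
              let inside : Edge 4 (2 * S + 1) → Prop := fun e => Λ e.1 ∧ Λ (Site.shift e.1 e.2)
              let refit : GaugeConfig 4 (2 * S + 1) SU3 → GaugeConfig 4 (2 * S + 1) SU3 :=
                fun W e => if inside e then W e else U e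
              let F : GaugeConfig 4 (2 * S + 1) SU3 → ℝ := fun W => ‖(diracMatrix (refit W) mb).det‖
              let wt : GaugeConfig 4 (2 * S + 1) SU3 → ℝ := fun W =>
                Real.exp (-(reg.β k * wilsonAction (fundamentalRep (Fin 3)) (refit W)))
              let haar : Measure (GaugeConfig 4 (2 * S + 1) SU3) := Measure.pi fun _ => haarProbability SU3
              let Dcut : GaugeConfig 4 (2 * S + 1) SU3 →
                  Matrix (FermiIdx Nf (2 * S + 1)) (FermiIdx Nf (2 * S + 1)) ℂ := fun W =>
                let Dη : Matrix (FermiIdx Nf (2 * S + 1)) (FermiIdx Nf (2 * S + 1)) ℂ :=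
                  Matrix.reindex quarkEquiv quarkEquiv (Matrix.of fun p q : QuarkVar Nf (2 * S + 1) =>
                    if p.1 = q.1 then
                      (wilsonDirac (fundamentalRep (Fin 3)) (refit W) (mb p.1) 1 -
                        ((η p.1 : ℂ) * Complex.I) • spinorLift (L := 2 * S + 1) (N := 3) gammaFive) p.2 q.2
                    else 0)
                Matrix.of fun i j =>
                  if Λ (quarkEquiv.symm i).2.1 ∧ Λ (quarkEquiv.symm j).2.1 then Dη i j
                  else if i = j then 1 else 0
              let G : GaugeConfig 4 (2 * S + 1) SU3 → ℝ := fun W =>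
                ∑ a : Fin 3, ∑ i : Fin 4, ∑ b : Fin 3, ∑ j : Fin 4,
                  ‖(Dcut W)⁻¹ (quarkEquiv (f, (Torus.proj (2 * S + 1) u, a, i)))
                    (quarkEquiv (f, (Torus.proj (2 * S + 1) v, b, j)))‖
              (∫ W, G W ^ s * (F W * wt W) ∂haar) / (∫ W, F W * wt W ∂haar) ≤
                C * Real.exp (-(δ * (reg.a k * ‖u - v‖)))

/-- **GlueCore — strong mixing of the phase-quenched conditional law at a physical rate, for all but rare
environments** (the Yang–Mills-hard core of the line, conclusion of stub 4, input of stubs 3, 5, 6). For every mass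
window and power `q` there are `γ > 0`, `C` such that for all large `k`, all `S ≥ L_k`, masses in the window and radii
`r' ≤ r < S` there is a measurable `Bad` with `⟨1_Bad⟩₊ ≤ C a_k^q` such that for any two environments `U, U' ∉ Bad`
and any measurable `g : configurations → [0,1]` depending only on the links inside `Λ_{r'}`: the conditional
phase-quenched expectations of `g` on the box `Λ_r` given the outside `U`, resp. `U'` (density
`∝ |det diracMatrix(refit W)| exp(−β_k S_W(refit W))`, FULL-torus determinant — the coupled, non-local weight is kept,
nothing finite-range is pretended), differ by at most `C (1 + a_k r')⁴ exp(−γ a_k (r − r'))` — prefactor in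
PHYSICAL units of the inner box, so the statement is uniform at fixed physical geometry as `a_k → 0`. Why "all but
rare environments": uniformly over ALL lattice-rough environments such total-variation closeness fails already for a
massive free field near its continuum limit (coherent rough boundary data carry unbounded physical energy); typical
environments average out (harmonic extension of lattice noise is `O(a_k)` at physical distance), and the atypical
ones are what `Bad` excises. -/
def GlueCore (Nf : ℕ) (reg : QCDRegularisation Nf) : Prop :=
  ∀ mlo mhi : ℝ, 0 < mlo → mlo ≤ mhi → ∀ q : ℕ,
    ∃ γ C : ℝ, 0 < γ ∧
      ∀ᶠ k in atTop, ∀ S : ℕ, reg.L k ≤ S →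
        ∀ m : Fin Nf → ℝ, (∀ f, mlo ≤ m f ∧ m f ≤ mhi) →
        ∀ r r' : ℕ, r' ≤ r → r < S →
          let mb : Fin Nf → ℝ := fun fl => reg.mcrit k + reg.a k * m fl / reg.Zm k
          let Λ : ℕ → TorusSite 4 (2 * S + 1) → Prop := fun ρ z => ∃ w ∈ box 4 ρ, Torus.proj (2 * S + 1) w = z
          let inside : ℕ → Edge 4 (2 * S + 1) → Prop := fun ρ e => Λ ρ e.1 ∧ Λ ρ (Site.shift e.1 e.2)
          let haar : Measure (GaugeConfig 4 (2 * S + 1) SU3) := Measure.pi fun _ => haarProbability SU3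
          let condExp : GaugeConfig 4 (2 * S + 1) SU3 → (GaugeConfig 4 (2 * S + 1) SU3 → ℝ) → ℝ := fun V g =>
            let refit : GaugeConfig 4 (2 * S + 1) SU3 → GaugeConfig 4 (2 * S + 1) SU3 :=
              fun W e => if inside r e then W e else V e
            let F : GaugeConfig 4 (2 * S + 1) SU3 → ℝ := fun W => ‖(diracMatrix (refit W) mb).det‖
            let wt : GaugeConfig 4 (2 * S + 1) SU3 → ℝ := fun W =>
              Real.exp (-(reg.β k * wilsonAction (fundamentalRep (Fin 3)) (refit W)))
            (∫ W, g (refit W) * (F W * wt W) ∂haar) / (∫ W, F W * wt W ∂haar)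
          ∃ Bad : Set (GaugeConfig 4 (2 * S + 1) SU3), MeasurableSet Bad ∧
            qcdPhaseQuenchedExpect (reg.β k) (2 * S + 1) mb (Bad.indicator fun _ => (1 : ℝ)) ≤ C * reg.a k ^ q ∧
            ∀ (U U' : GaugeConfig 4 (2 * S + 1) SU3), U ∉ Bad → U' ∉ Bad →
            ∀ (g : GaugeConfig 4 (2 * S + 1) SU3 → ℝ), Measurable g → (∀ W, 0 ≤ g W ∧ g W ≤ 1) →
              (∀ W W' : GaugeConfig 4 (2 * S + 1) SU3, (∀ e, inside r' e → W e = W' e) → g W = g W') →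
              |condExp U g - condExp U' g| ≤
                C * (1 + reg.a k * r') ^ 4 * Real.exp (-(γ * (reg.a k * ((r : ℝ) - r'))))

/-- **LatticeGapUniform — the all-volume, all-observable, SIGNED lattice gap with `m`-locally-uniform constants**
(conclusion of stub 5): for every mass window there is `Δ > 0` such that for every pair of gauge-invariant local
lattice QCD observables there is `C` with, for all large `k`, all masses in the window, all tori `S ≥ L_k` and
`n ≤ S`, `‖⟨A · τ_{ne₀}B⟩_{k,S} − ⟨A⟩⟨B⟩‖ ≤ C e^{−Δ a_k n}` (honest signed functional `qcdLatticeConnectedCorr`).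
Specialises to `(reg.scheme m z shift).HasLatticeMassGap Δ` for each `m`, and passes to subsequences. -/
def LatticeGapUniform (Nf : ℕ) (reg : QCDRegularisation Nf) : Prop :=
  ∀ mlo mhi : ℝ, 0 < mlo → mlo ≤ mhi → ∃ Δ : ℝ, 0 < Δ ∧
    ∀ (R R' : ℕ) (A : QCDLatticeObservable Nf R) (B : QCDLatticeObservable Nf R'), ∃ C : ℝ,
      ∀ᶠ k in atTop, ∀ m : Fin Nf → ℝ, (∀ f, mlo ≤ m f ∧ m f ≤ mhi) → ∀ S : ℕ, reg.L k ≤ S → ∀ n : ℕ, n ≤ S →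
        ‖qcdLatticeConnectedCorr (reg.β k) (2 * S + 1) (fun fl => reg.mcrit k + reg.a k * m fl / reg.Zm k) A B n‖ ≤
          C * Real.exp (-(Δ * (reg.a k * n)))

/-- The regularisation read along the subsequence `φ` (`a, β, L, m_crit, Z_m` precomposed; the `Tendsto` fields
pass by `StrictMono.tendsto_atTop`). `QCDOf`'s own `reg'` in the composition. -/
def subseq (reg : QCDRegularisation Nf) (φ : ℕ → ℕ) (hφ : StrictMono φ) : QCDRegularisation Nf where
  a := reg.a ∘ φ
  a_pos k := reg.a_pos (φ k)
  tendsto_a := reg.tendsto_a.comp hφ.tendsto_atTop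
  β := reg.β ∘ φ
  L := reg.L ∘ φ
  tendsto_L := reg.tendsto_L.comp hφ.tendsto_atTop
  mcrit := reg.mcrit ∘ φ
  Zm := reg.Zm ∘ φ
  Zm_pos k := reg.Zm_pos (φ k)

/-- `HasMassScaling` passes to subsequences. -/
theorem hasMassScaling_subseq {reg : QCDRegularisation Nf} (h : reg.HasMassScaling) (φ : ℕ → ℕ)
    (hφ : StrictMono φ) : (subseq reg φ hφ).HasMassScaling := by
  obtain ⟨c, hc, ht⟩ := h
  exact ⟨c, hc, ht.comp hφ.tendsto_atTop⟩

/-- Unfolding the subsequence scheme: torus half-sides. -/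
@[simp] theorem subseq_scheme_L (reg : QCDRegularisation Nf) (φ : ℕ → ℕ) (hφ : StrictMono φ)
    (m : Fin Nf → ℝ) (z shift : QCDField Nf → ℕ → ℝ) (k : ℕ) :
    ((subseq reg φ hφ).scheme m z shift).L k = reg.L (φ k) := rfl

/-- Unfolding the subsequence scheme: bare masses. -/
@[simp] theorem subseq_scheme_mq (reg : QCDRegularisation Nf) (φ : ℕ → ℕ) (hφ : StrictMono φ)
    (m : Fin Nf → ℝ) (z shift : QCDField Nf → ℕ → ℝ) (fl : Fin Nf) (k : ℕ) :
    ((subseq reg φ hφ).scheme m z shift).mq fl k = reg.mcrit (φ k) + reg.a (φ k) * m fl / reg.Zm (φ k) := rfl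



/-! ## Stubs (the six open lemmas of the line; `sorry` only here) -/

/-- **Stub 1 (K1_loc).** Local two-star fibre cofactor domination for Dirichlet-cut, twisted Wilson–Dirac
operators, constants uniform in `m₀ ∈ [−2,2]`, `|η| ≤ 1`, polynomial in the box radius. Why plausibly true: the
K1 mechanism (two-star Schur complement `S(W) = (m₀+4)·1 − H₀𝒲Γ𝒲†H₀†` on the 24-dimensional `{x,y}` block;
`adj = det · G` is pole-free and `γ₅`-hermiticity puts the same eigenvector at both ends of every pole; a simple
zero mode supported off `{x,y}` kills `adj_xy` too) is insensitive to the boundary condition and to the diagonal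
twist; at `η ≠ 0` it holds trivially with `C = 1/|η|` (`det_twisted_pos`), the content is uniformity as `η → 0`;
the local count replacing `1 + n_w` is bounded by the dimension `12(2r+1)⁴`, and for `2r+1 ≥ L` this is K1
(11510) with `1 + n_w ≤ 13 L⁴`; the route's kit evidence (j002114…j002690: two-star ratio ≤ 1.42 in `d = 2`, `1.0`
in `d = 4`). Size L (same as 11510; the strengthening is uniformity of the constants over the compact mass range and
the Dirichlet cut). Leans on: `wilsonDirac`, `spinorLift`, `gammaFive`, `Matrix.adjugate`, `fundamentalRep`;
`WilsonDeterminantMassSplitting.det_twisted_pos` for `η ≠ 0`. -/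
theorem stub_localFibreDomination : LocalFibreDomination := by
  sorry

/-- **Stub 2 (K3_gen).** Band-limited tilted flatness and relative small balls for products of cut/twisted
Wilson determinants under the star-conditional Wilson law, degree-only constants. Why plausibly true: every such
`F` lies, for ALL `L, U, r, mq, η`, in one finite-dimensional space of matrix coefficients of bidegree
`≤ (6n, 6n)` per star link (rank-6 hop blocks; the twist and the cut do not touch the link dependence), on which
(a) is Laplace at scale `β^{-1/2}` + Nikolskii/Remez on the real-algebraic manifold `SU(3)^16` and (b) is the
Carbery–Wright / Remez–Turán–Nazarov small-ball inequality for polynomials under a log-concave-cored law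
(tree: `CarberyWright.supSublevelBound`, `.supLeGeometricMean`, vendored p59573). Size M for (a), M–L for (b)
(uniformity in `β` is 11511's recorded risk). Leans on: `PauliBandLimit` (11514), `SingleLinkFlatness` (11515),
`SingleLinkLogFlatness` (11516), `Literature.Analysis.Approximation.CarberyWright`. -/
theorem stub_bandLimitedFlatness : BandLimitedFlatness := by
  sorry

/-- **Stub 3 (ConditionalFMDecay).** The fibre lemmas turn the GLOBAL, `η = 0`, `m`-pointwise clause (ii) into
the conditional, twisted, `m`-locally-uniform decay `CondDecay` (good environments, inner half-boxes). Why plausibly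
true / plan: Aizenman–Schenker–Friedrich–Hundertmark's finite-volume criterion run INSIDE `Λ_r` for the
Dirichlet-cut resolvent — a-priori bound `E_ν[‖G_Λ(x,u)‖^{s'}] ≤ A` on every two-star fibre from K1_loc
(`‖adj‖ ≤ C(1+r)^p sup|det|`) and K3_gen ((a) for the tilt `∏_f|det D_full|`, (b) for `|det D_Λ|`:
`E_ν[(M/|det|)^{s'}] ≤ C(1+β)^p ∫₀^∞ ν_wt(…) < ∞` for `s' < c`), decoupling across two stars by the same fibrewise
reverse Hölder (PWS's foreseen DecouplingLemma; no independence) — all of it uniform in EVERYTHING outside the two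
stars by statement; smallness SEED at one log-scale `ℓ₀ ≍ K₀ log(1/a_k)/a_k` from (ii) (global decay ⇒ the averaged
boxed criterion via the geometric resolvent identity), transported from the average to every environment outside a
set `Bad` of phase-quenched probability `≤ √seed` by Markov's inequality, union bounds over the `(2r+1)^8` pairs and
sub-boxes paid from the `a_k^{sδK₀}` room (`K₀ = K₀(q)`), bad INNER sub-configurations absorbed by Hölder against the
a-priori bound; the twist `|η| ≤ η₀` rides along (K1_loc/K3_gen are stated twisted; `(D − iηΓ₅)⁻¹ − D⁻¹ =
iη D⁻¹Γ₅(D − iηΓ₅)⁻¹` inside the box costs `η₀ · |Λ_ℓ₀| · A`); the `m`-LOCAL UNIFORMITY is manufactured here and is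
the stub's honest extra burden (F3: `H` is `m`-pointwise; if the tenure planners restate 9150 (ii) with
`∀ K compact ∃ s δ C`, the seed strengthens accordingly and this becomes the ASFH-type equivalence of finite-volume
criteria). Second risk: `C` uniform in `k` at SHORT distances needs the `(1+β_k)^p` of K3(a) not to propagate (the
`|det|`-tilt suppresses, not enhances, near-singular configurations). Size L (≥ FMClosureUnquenched 11512).
Consumes (i) (bare masses eventually in `(−1, ·)`, so the fibre lemmas' mass range applies or the hopping series
converges outright) and (ii). Needs NO gluonic input. -/
theorem stub_conditionalFMDecay (hK1 : LocalFibreDomination) (hK3 : BandLimitedFlatness)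
    (hNf : Nf = 2 ∨ Nf = 3) (reg : QCDRegularisation Nf)
    (hI : ∀ m : Fin Nf → ℝ, (∀ f, 0 < m f) → ClauseI reg m)
    (hII : ∀ m : Fin Nf → ℝ, (∀ f, 0 < m f) → ClauseII reg m) : CondDecay Nf reg := by
  sorry

/-- **Stub 4 (GlueCore from the trajectory).** An asymptotically free, mass-scaling regularisation whose quarks
stay on the physical branch (i), are localised in fractional moment (ii) and conditionally (`CondDecay`), with the
fibre lemmas at hand, has a strongly mixing phase-quenched conditional law at a physical rate for all but rare
environments, locally uniformly in the masses. Why plausibly true: this is the Yang–Mills mass gap in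
Dobrushin–Shlosman/Olivieri finite-size form for the pure-gauge factor (Bałaban's renormalisation-group control of
the small-field region + large-field suppression; believed, open), restricted to typical environments (coherent
lattice-rough environments, which carry unbounded physical energy and defeat total-variation closeness even for a
free field, are excised by `Bad` — for typical ones the harmonic extension of lattice noise is `O(a_k)` at physical
distance), plus screening of the determinant's non-local coupling by quark localisation (`∂_e log|det D| =
Re tr[D⁻¹∂_eD]` is a local propagator trace; its dependence on far links is a product of two decaying propagators,
`CondDecay`; the tilt's flatness per refit is K3_gen). It is the Yang–Mills-hard stub every line for this crux must
contain (`Negative.withoutPerMass_iff_QCD`, Disproof `iff_QCD_of_hyp`); bounds-type, so interleaving/subsequences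
preserve it. Size: open problem. Consumes HasMassScaling, HasAsymptoticScaling, (i), (ii). -/
theorem stub_glueCore (hNf : Nf = 2 ∨ Nf = 3) (reg : QCDRegularisation Nf)
    (hMS : reg.HasMassScaling) (hAS : (reg.scheme 0 0 0).HasAsymptoticScaling)
    (hI : ∀ m : Fin Nf → ℝ, (∀ f, 0 < m f) → ClauseI reg m)
    (hII : ∀ m : Fin Nf → ℝ, (∀ f, 0 < m f) → ClauseII reg m)
    (hK1 : LocalFibreDomination) (hK3 : BandLimitedFlatness) (hD : CondDecay Nf reg) : GlueCore Nf reg := by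
  sorry

/-- **Stub 5 (sign-defect gas ⇒ signed all-volume lattice gap).** Given the gluonic core, the conditional quark
decay, the fibre lemmas and sign coherence (iv) at the scheme's own side, the honest SIGNED connected correlations of
all gauge-invariant local lattice QCD observables decay at a physical rate on ALL tori `S ≥ L_k`, `m`-locally
uniformly. Plan, three named internal lemmas: (1) DefectLocality — `sgn det D_f = sgn det(Γ₅D_f)` written through
the `η`-integral of twisted propagators `(D_f − iηΓ₅)⁻¹Γ₅` (`CondDecay` at `|η| ≤ η₀`, `det_twisted_pos` beyond),
so the sign is a product of quasi-local factors up to `CondDecay`-small errors off the `Bad` sets; (2) DefectRarity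
— with (1) and `GlueCore` the sign average on a torus of physical volume `V` is `≈ exp(−2ρ_k V)`, and (iv) at
`V_k = (a_k(2L_k+1))⁴ → ∞` (`reg.tendsto_L`) forces `ρ_k ≤ (log 2)/(2V_k) → 0` (triage r1-2: rarity is not an
independent law); (3) Kotecký–Preiss expansion of the defect- and bad-block-decorated measure `|w| · ∏ σ_defect`
relative to the `GlueCore` reference at a physical block scale (tree `ClusterExpansion.IsKPVolume`,
`polymerPartitionFunction_ne_zero_of_kp`, `koteckyPreiss_truncatedWeight_bound` — BCO-type graded expansion from a
finite-size mixing condition; bad blocks are polymers of weight `≤ C a_k^q`), activities of fermionic observables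
through Jacobi-WHOLE complementary minors (one minor per flavour, all moments `s ≤ 1` finite — F4; split-mass hairpin
× hairpin is termwise non-integrable under `|w|` and is never formed; `r×r` minors are band-limited of the same type,
K3_gen), quark lines from `CondDecay`. The crux's own why-might-fail (`⟨σ⟩_{|w|} ~ exp(−c(a_kS)⁴) → 0` for `S ≫ L_k`)
is met in log-partition form: the expansion controls `log Z_signed − log Z_{|w|}` extensively, so vanishing `⟨σ⟩` is
harmless while `ρ_k × (correlation volume) ≪ 1`. What it must NOT use: sign coherence at `S > L_k`
(`Negative.blocks_half_le_pow_all_iff`: asking it on all tori forbids defects altogether). Size: open problem (the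
sign problem of the crux). Consumes (iv). -/
theorem stub_defectGasLatticeGap (hNf : Nf = 2 ∨ Nf = 3) (reg : QCDRegularisation Nf)
    (hIV : ∀ m : Fin Nf → ℝ, (∀ f, 0 < m f) → ClauseIV reg m)
    (hK1 : LocalFibreDomination) (hK3 : BandLimitedFlatness)
    (hG : GlueCore Nf reg) (hD : CondDecay Nf reg) : LatticeGapUniform Nf reg := by
  sorry

/-- **Stub 6 (continuum package at the scheme volume, one subsequence for all masses).** Given the trajectory's
scaling clauses, (i), (iii), (iv), the gluonic core, the conditional quark decay and the `m`-locally-uniform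
lattice gap, there is ONE strictly increasing `φ` such that for EVERY `m > 0` the lattice QCD `n`-point functions
along `reg ∘ φ` (suitably renormalised: `z, shift` may depend on `m`) converge to OS data `T` with `IsQCDAlong`,
non-trivial non-Gaussian glue, non-decoupled flavour-changing pseudoscalars and a mass gap `Δ_T > 0` of their
own. Plan: all OS-data clauses evaluate tori of side `2L_k+1` only (F1; triage S1), where (iv) makes the honest
functional a factor-2 perturbation of the phase-quenched one for norm-INSIDE quantities
(`Negative.detRatio_le_two_mul_absMoment`, `qcdTorusExpect_eq_detRatio`; the a.e. `det ≠ 0` it needs is the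
line's first support lemma — real-analytic zero sets are Haar-null) and, with DefectRarity of stub 5, an `o_k(1)`
one for lower bounds (F2); UV stability of renormalised correlators (bounds-type ⇒ subsequences), equicontinuity
in `m` from `LatticeGapUniform`/`CondDecay` (insertions of the mass term summed against `m`-uniform clustering)
⇒ Arzelà–Ascoli on compacts exhausting `(0,∞)^{N_f}` and a diagonal `φ` (the `∀ m` hole F3 is closed HERE,
with `φ` before `∀ m`); (iii) ⇒ the flavour-changing pseudoscalar two-point function survives (non-decoupling);
(i) ⇒ the physical-branch clause of `IsQCDAlong` verbatim; `HasAsymptoticScaling` passes to `φ`; E0–E4 by OS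
reconstruction from the (site-)reflection-positive lattice theory at `m_f(k) > −1`; non-Gaussianity of glue and
`Δ_T > 0` from the clustering of physically-sized smeared observables at the scheme volume (re-derived from
`CondDecay`/`GlueCore`). Deliberately does NOT infer `T.HasMassGap Δ` from the fixed-size lattice inequality at rate
`Δ` (unrenormalised fixed-size observables can hide an inflated rate behind vanishing normalisations when `a_kL_k`
grows slowly; and `S > L_k` values may be junk, `Negative.qcdLatticeConnectedCorr_eq_zero_of_signedZ_eq_zero`): it
outputs its own `Δ_T`, and the composition takes `min`. Size: open problem (UV half: continuum limit of an
asymptotically free gauge theory with E0–E4 and non-Gaussian glue). Consumes scaling, (i), (iii), (iv). -/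
theorem stub_continuumPackage (hNf : Nf = 2 ∨ Nf = 3) (reg : QCDRegularisation Nf)
    (hMS : reg.HasMassScaling) (hAS : (reg.scheme 0 0 0).HasAsymptoticScaling)
    (hI : ∀ m : Fin Nf → ℝ, (∀ f, 0 < m f) → ClauseI reg m)
    (hIII : ∀ m : Fin Nf → ℝ, (∀ f, 0 < m f) → ClauseIII reg m)
    (hIV : ∀ m : Fin Nf → ℝ, (∀ f, 0 < m f) → ClauseIV reg m)
    (hG : GlueCore Nf reg) (hD : CondDecay Nf reg) (hL : LatticeGapUniform Nf reg) :
    ∃ (φ : ℕ → ℕ) (hφ : StrictMono φ), ∀ m : Fin Nf → ℝ, (∀ f, 0 < m f) →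
      ∃ (z shift : QCDField Nf → ℕ → ℝ) (T : OSData (QCDField Nf) 4),
        IsQCDAlong ((subseq reg φ hφ).scheme m z shift) T ∧ T.IsNontrivial QCDField.glue ∧
          T.IsNonGaussian QCDField.glue ∧
            (∀ f g : Fin Nf, f ≠ g → T.IsNontrivial (QCDField.pseudoRe f g)) ∧
              ∃ Δ : ℝ, 0 < Δ ∧ T.HasMassGap Δ := by
  sorry

/-! ## Glue (sorry-free) -/

/-- A positive mass tuple of `N_f ∈ {2,3}` flavours lies in a compact window `[mlo, mhi] ⊂ (0, ∞)`. -/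
theorem exists_massWindow (hNf : Nf = 2 ∨ Nf = 3) (m : Fin Nf → ℝ) (hm : ∀ f, 0 < m f) :
    ∃ mlo mhi : ℝ, 0 < mlo ∧ mlo ≤ mhi ∧ ∀ f, mlo ≤ m f ∧ m f ≤ mhi := by
  have hne : (Finset.univ : Finset (Fin Nf)).Nonempty := by
    rcases hNf with rfl | rfl <;> exact Finset.univ_nonempty
  obtain ⟨f₁, -, hf₁⟩ := Finset.exists_mem_eq_inf' hne m
  refine ⟨Finset.univ.inf' hne m, Finset.univ.sup' hne m, ?_, ?_, fun f => ⟨?_, ?_⟩⟩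
  · rw [hf₁]; exact hm f₁
  · exact (Finset.inf'_le _ (Finset.mem_univ f₁)).trans (Finset.le_sup' _ (Finset.mem_univ f₁))
  · exact Finset.inf'_le _ (Finset.mem_univ f)
  · exact Finset.le_sup' _ (Finset.mem_univ f)

/-- The OS mass gap is antitone in the rate (constants may be enlarged to `max C 0`). -/
theorem hasMassGap_anti {ι : Type} {T : OSData ι 4} {Δ Δ' : ℝ} (h : T.HasMassGap Δ) (hle : Δ' ≤ Δ) :
    T.HasMassGap Δ' := by
  intro n m k k' F G hF hG
  obtain ⟨C, hC⟩ := h n m k k' F G hF hG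
  refine ⟨max C 0, fun t ht H hH => (hC t ht H hH).trans ?_⟩
  calc C * Real.exp (-Δ * t) ≤ max C 0 * Real.exp (-Δ * t) :=
        mul_le_mul_of_nonneg_right (le_max_left _ _) (Real.exp_pos _).le
    _ ≤ max C 0 * Real.exp (-Δ' * t) :=
        mul_le_mul_of_nonneg_left (Real.exp_le_exp.2 (by nlinarith)) (le_max_right _ _)

/-- The lattice decay inequality is antitone in the rate. -/
theorem latticeBound_anti {x C Δ Δ' a : ℝ} {n : ℕ} (h : x ≤ C * Real.exp (-(Δ * (a * n)))) (hle : Δ' ≤ Δ)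
    (ha : 0 < a) : x ≤ max C 0 * Real.exp (-(Δ' * (a * n))) := by
  refine h.trans ?_
  have han : 0 ≤ a * n := mul_nonneg ha.le (Nat.cast_nonneg n)
  calc C * Real.exp (-(Δ * (a * n))) ≤ max C 0 * Real.exp (-(Δ * (a * n))) :=
        mul_le_mul_of_nonneg_right (le_max_left _ _) (Real.exp_pos _).le
    _ ≤ max C 0 * Real.exp (-(Δ' * (a * n))) :=
        mul_le_mul_of_nonneg_left (Real.exp_le_exp.2 (by nlinarith)) (le_max_right _ _)

/-- **The composition** — concludes the crux BY NAME. `H` is destructured into its scaling clauses and the four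
per-mass clauses (definitionally the local `ClauseI…IV`); `PQFD` is discarded (see the module docstring);
stubs 3 → 4 → 5 → 6; `reg' := subseq reg φ`; per mass tuple, `Δ := min Δ_T Δ_K`. -/
theorem GluonicCompletion_of : Summit.QuantumFields.QCD.Theses.PauliWegnerSea.GluonicCompletion := by
  intro Nf hNf hyp
  obtain ⟨reg, hMS, hAS, hper⟩ := hyp
  have hI : ∀ m : Fin Nf → ℝ, (∀ f, 0 < m f) → ClauseI reg m := fun m hm => (hper m hm).1.1
  have hII : ∀ m : Fin Nf → ℝ, (∀ f, 0 < m f) → ClauseII reg m := fun m hm => (hper m hm).1.2.1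
  have hIII : ∀ m : Fin Nf → ℝ, (∀ f, 0 < m f) → ClauseIII reg m := fun m hm => (hper m hm).1.2.2.1
  have hIV : ∀ m : Fin Nf → ℝ, (∀ f, 0 < m f) → ClauseIV reg m := fun m hm => (hper m hm).1.2.2.2
  have hD : CondDecay Nf reg :=
    stub_conditionalFMDecay stub_localFibreDomination stub_bandLimitedFlatness hNf reg hI hII
  have hG : GlueCore Nf reg :=
    stub_glueCore hNf reg hMS hAS hI hII stub_localFibreDomination stub_bandLimitedFlatness hD
  have hL : LatticeGapUniform Nf reg :=
    stub_defectGasLatticeGap hNf reg hIV stub_localFibreDomination stub_bandLimitedFlatness hG hD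
  obtain ⟨φ, hφ, hT⟩ := stub_continuumPackage hNf reg hMS hAS hI hIII hIV hG hD hL
  refine ⟨subseq reg φ hφ, hasMassScaling_subseq hMS φ hφ, fun m hm => ?_⟩
  obtain ⟨mlo, mhi, hlo, hlohi, hmK⟩ := exists_massWindow hNf m hm
  obtain ⟨ΔK, hΔK, hgap⟩ := hL mlo mhi hlo hlohi
  obtain ⟨z, shift, T, hQ, hN, hNG, hP, ΔT, hΔT, hTgap⟩ := hT m hm
  refine ⟨z, shift, T, hQ, hN, hNG, hP, min ΔT ΔK, lt_min hΔT hΔK,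
    hasMassGap_anti hTgap (min_le_left _ _), ?_⟩
  intro R R' A B
  obtain ⟨C, hC⟩ := hgap R R' A B
  refine ⟨max C 0, (hφ.tendsto_atTop.eventually hC).mono fun k hk S hS n hn => ?_⟩
  exact latticeBound_anti (hk m hmK S hS n hn) (min_le_right _ _) (reg.a_pos (φ k))

/-- The shared crux on its other route: `WilsonMobilityGap.GluonicCompletion` (stmt-QuantumFields-9152 is wanted by both
routes; the two gate-written copies are syntactically identical, Disproof `eq_wilsonMobilityGap`), concluded BY NAME. -/
theorem GluonicCompletion_of_wilsonMobilityGap :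
    Summit.QuantumFields.QCD.Theses.WilsonMobilityGap.GluonicCompletion :=
  GluonicCompletion_of

/-! ## Checks against the landed Negative lemmas (documentation; sorry-free) -/

/-- No stub may ask sign coherence with a constant `> 1`: the clause would be unsatisfiable
(`Negative.not_eventually_le_signRatio_of_one_lt`, specialised to the bare trajectory of `(reg, m)`). -/
example (reg : QCDRegularisation Nf) (m : Fin Nf → ℝ) {c : ℝ} (hc : 1 < c) :
    ¬ ∀ᶠ k in atTop, c ≤ ‖∫ U : GaugeConfig 4 (2 * reg.L k + 1) SU3,
        (diracMatrix U fun fl => reg.mcrit k + reg.a k * m fl / reg.Zm k).det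
          ∂(wilsonMeasure (d := 4) (L := 2 * reg.L k + 1) (fundamentalRep (Fin 3)) (reg.β k))‖ /
        ∫ U : GaugeConfig 4 (2 * reg.L k + 1) SU3,
          ‖(diracMatrix U fun fl => reg.mcrit k + reg.a k * m fl / reg.Zm k).det‖
            ∂(wilsonMeasure (d := 4) (L := 2 * reg.L k + 1) (fundamentalRep (Fin 3)) (reg.β k)) :=
  Summit.QuantumFields.QCD.Theorems.GluonicCompletion.Negative.not_eventually_le_signRatio_of_one_lt hc
    reg.L reg.β fun k fl => reg.mcrit k + reg.a k * m fl / reg.Zm k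

/-- Dropping the whole per-mass package would turn the crux into `QCD` itself (`Negative.withoutPerMass_iff_QCD`):
the reason stubs 4–6 are open-problem-sized and the line is explicit about which clauses each consumes. -/
example : (∀ Nf : ℕ, Nf = 2 ∨ Nf = 3 →
    (∃ reg : QCDRegularisation Nf, reg.HasMassScaling ∧ (reg.scheme 0 0 0).HasAsymptoticScaling) → QCDOf Nf) ↔
      _root_.QCD :=
  Summit.QuantumFields.QCD.Theorems.GluonicCompletion.Negative.withoutPerMass_iff_QCD

end Summit.QuantumFields.QCD.Cruxes.GluonicCompletion.FibreFlatnessConditionalPackage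

end
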